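import Literature.Probability.RandomPlanarGeometry.HexParafermionProofs
import HarnessLib

/-!
# Boundary winding rigidity for self-avoiding walks, I: closed walks, splicing, orientation

Route `SAWDefectDecoherence`, support item `BoundaryWindingRigidity` (stmt-CriticalPhenomena-8515):
for a simply connected hexagonal-lattice domain `Ω` (vertex set `Λ`, "connected complement") and
two boundary mid-edges `a, b ∈ ∂Ω`, all self-avoiding walks `γ ⊂ Ω : a → b` have the same winding
`W_γ(a, b)` (Duminil-Copin–Smirnov 2012, §4: "the winding of an interface leading to a boundary
edge `z` is uniquely determined"). This first file collects the lattice lemmas in the coordinate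
model `HV` of `HexSAWWinding.lean`; the theorem itself is assembled in
`SAWDefectDecoherenceBoundaryWindingRigidity.lean`.

## Contents (namespace `Summit.CriticalPhenomena.SAWScalingLimit.Theorems.BoundaryWindingRigidity`)

* `winding_eq_pturn_code`: the geometric winding of a nontrivial walk between mid-edges is
  `(π/3) · pturn` of its code `wOut :: Φ(verts) ++ [Φ e]` (extracted from the proof of
  `HexMidEdgeSAW.weight_eq_pwt`);
* `wnd_eq_zero_of_simplyConnected'`: for `Λ` with connected complement and the entrance
  `u ∉ Λ` at `wOut`, every CLOSED lattice walk of `Φ(Λ)` has winding number `0` around the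
  entrance face `(1, 0)` (the tree's `HV.wnd_eq_zero_of_simplyConnected` with "simple cycle"
  weakened to "closed walk": its proof only uses the adjacency of the darts);
* `dwnd_pdarts_eq_of_endpoints`: hence the winding sum around `(1, 0)` of the darts of a
  lattice path of `Φ(Λ)` only depends on its endpoints (splice two such paths into a closed
  walk, `wnd_tail_append_tail`);
* `cturn_and_wnd_entrance`, `cturn_eq_of_wnd_entrance_eq`: a simple cycle through the entrance
  dart `wOut → hvOrigin` has turning number `+6` and winding number `0` at `(1, 0)`, or `-6`
  and `-1` (the discrete Umlaufsatz `HV.good_or_good_reverse` of the tree plus the jump of the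
  winding number across a dart), so two such cycles with the same winding number at the
  entrance face turn the same way.
-/

noncomputable section

open Finset Literature.Probability.LatticeModels Literature.Probability.Percolation
open Literature.Probability.RandomPlanarGeometry.SAW
open Literature.Probability.RandomPlanarGeometry.SAW.HV

namespace Summit.CriticalPhenomena.SAWScalingLimit.Theorems.BoundaryWindingRigidity

/-! ### The winding of a walk is the turn sum of its code -/

section Code

variable {Λ : Finset HexVertex} {a : Sym2 HexVertex} {u w₁ v t : HexVertex}
  {Φ : hexGraph ≃g hvGraph} {α β : ℂ}

/-- **The geometric winding of a nontrivial walk between mid-edges is `(π/3) · pturn` of its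
code** `wOut :: Φ(verts) ++ [Φ e]` (`e` the far end of the final mid-edge): the two half-edges do
not turn, the chart is a similarity, and the turns of the honeycomb lattice are `±π/3`
(extracted from the proof of `HexMidEdgeSAW.weight_eq_pwt`).
[cite: DuminilCopinSmirnov2012, §2 (winding)] -/
theorem winding_eq_pturn_code (γ : HexMidEdgeSAW Λ a s(v, t)) (ha : a = s(u, w₁))
    (hu : u ∉ Λ) (hΦu : Φ u = wOut) (hΦw : Φ w₁ = hvOrigin) (hvt : hexGraph.Adj v t)
    (haff : ∀ f, emb (pos (Φ f)) = α * hexCenter f + β) (hα : α ≠ 0)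
    (hne : γ.verts ≠ []) {e : HexVertex}
    (he : (γ.verts.getLast hne = v ∧ e = t) ∨ (γ.verts.getLast hne = t ∧ e = v)) :
    γ.winding = (Real.pi / 3) * pturn (wOut :: (γ.verts.map Φ ++ [Φ e])) := by
  have hmw := γ.isMidWalk_code Φ ha hu hΦu hΦw hvt hne he
  set m := γ.verts.map Φ with hm
  have hmne : m ≠ [] := by simpa [hm] using hne
  have hcode : wOut :: (m ++ [Φ e]) = (u :: (γ.verts ++ [e])).map Φ := by
    simp [hm, hΦu]
  have hc : ∀ f, hexCenter f = α⁻¹ * emb (pos (Φ f)) + -(β / α) := by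
    intro f; rw [haff]; field_simp; ring
  rw [γ.winding_eq_winding_map ha hu hne he]
  have e1 : (u :: (γ.verts ++ [e])).map hexCenter =
      (((u :: (γ.verts ++ [e])).map Φ).map fun y => emb (pos y)).map
        fun z => α⁻¹ * z + -(β / α) := by
    simp only [List.map_map]
    exact List.map_congr_left fun f _ => hc f
  rw [e1, winding_map_affine (inv_ne_zero hα), ← hcode]
  refine winding_map_emb_pos _ hmw.1 ?_
  -- no backtracking in the code
  have hQ : (wOut :: m).Nodup := by
    refine List.nodup_cons.2 ⟨fun h => hu ?_, γ.nodup.map Φ.injective⟩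
    rw [hm, ← hΦu, List.mem_map] at h
    obtain ⟨y, hy, hyu⟩ := h
    exact Φ.injective hyu ▸ γ.subset y hy
  have hnb : ∀ (i : ℕ) (hi : i + 2 < ((wOut :: m) ++ [Φ e]).length),
      ((wOut :: m) ++ [Φ e])[i] ≠ ((wOut :: m) ++ [Φ e])[i + 2] := by
    intro i hi
    by_cases h2 : i + 2 < (wOut :: m).length
    · rw [List.getElem_append_left (by omega), List.getElem_append_left h2]
      intro h
      have := (hQ.getElem_inj_iff).1 h
      omega
    · have hlen : i + 2 = (wOut :: m).length := by
        simp only [List.length_append, List.length_singleton] at hi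
        omega
      rw [List.getElem_append_left (by omega), List.getElem_concat_length hlen,
        ← prevOf_eq_getElem_cons hmne (by omega) (by simp at hlen; omega)]
      exact (γ.map_ne_prevOf ha hu hΦu hne he).symm
  exact hnb

end Code

/-! ### The entrance face is outside every closed walk of `Φ(Λ)` -/

section Outside

variable {Λ : Finset HexVertex} {u : HexVertex} {Φ : hexGraph ≃g hvGraph}

/-- **"`a ∈ ∂Ω`, `Ω` simply connected" in winding numbers, for closed walks**: if the complement
of `Λ` is connected in `ℍ` and `u ∉ Λ` is sent to `wOut` by the chart `Φ`, then every closed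
lattice walk of `Φ(Λ)` (a cyclic vertex list all of whose cyclic darts are edges, repetitions
allowed) has winding number `0` around the face `(1, 0)` at the entrance dart. This is
`HV.wnd_eq_zero_of_simplyConnected` with the hypothesis "simple cycle" weakened to "closed walk"
(its proof only uses the adjacency of the darts): `u` is joined to a far vertex by a lattice path
avoiding `Λ`, along which the winding number is constant, and it vanishes far away.
[cite: DuminilCopinSmirnov2012, §2 ("simply connected, i.e. having a connected complement")] -/
theorem wnd_eq_zero_of_simplyConnected' (hΛ : hexDomainSimplyConnected Λ) (hu : u ∉ Λ)
    (hΦu : Φ u = wOut) (c : List HV) (hc : ∀ x ∈ c, x ∈ Λ.map Φ.toEquiv.toEmbedding)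
    (hadj : ∀ d ∈ cdarts c, hvGraph.Adj d.1 d.2) : wnd c (1, 0) = 0 := by
  classical
  set V := Λ.map Φ.toEquiv.toEmbedding with hV
  -- a bound on the first coordinates of `V`
  obtain ⟨N, hN⟩ := Finset.exists_le (V.image fun x : HV => x.1)
  have hN' : ∀ x ∈ V, x.1 ≤ N := fun x hx => hN _ (Finset.mem_image_of_mem _ hx)
  -- a far vertex outside `Λ`
  set y' : HV := (N + 1, 0, false) with hy'
  set y₀ : HexVertex := Φ.symm y' with hy₀
  have hyy : Φ y₀ = y' := RelIso.apply_symm_apply Φ y'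
  have hy₀Λ : y₀ ∉ Λ := fun h => by
    have := hN' (Φ y₀) (Finset.mem_map_of_mem _ h)
    rw [hyy, hy'] at this
    simp at this
  -- a lattice path from `u` to `y₀` avoiding `Λ`
  obtain ⟨W⟩ := hΛ ⟨u, by simpa using hu⟩ ⟨y₀, by simpa using hy₀Λ⟩
  set Q : List HV := W.support.map fun x => Φ x.1 with hQ
  have hQc : Q.IsChain hvGraph.Adj := by
    rw [hQ, List.isChain_map]
    exact List.IsChain.imp (fun x y h => (Φ.map_rel_iff).2 h) W.isChain_adj_support
  have hQV : ∀ x ∈ Q, x ∉ V := by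
    intro x hx hxV
    obtain ⟨z, -, rfl⟩ := List.mem_map.1 hx
    obtain ⟨z', hz', hzz⟩ := Finset.mem_map.1 hxV
    change Φ z' = Φ z.1 at hzz
    exact z.2 (Φ.injective hzz ▸ hz')
  have hQne : Q ≠ [] := by simp [hQ]
  have hQlast : Q.getLast hQne = y' := by
    rw [← hyy]
    simp [hQ, List.getLast_map, W.getLast_support]
  obtain ⟨Qt, hQt⟩ : ∃ Qt, Q = wOut :: Qt := by
    refine ⟨W.support.tail.map fun x => Φ x.1, ?_⟩
    have e := congrArg (List.map fun x => Φ x.1) W.cons_tail_support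
    simp only [List.map_cons] at e
    rw [hQ, ← e, hΦu]
  obtain ⟨Q₀, hQ₀⟩ : ∃ Q₀, Q = Q₀ ++ [y'] :=
    ⟨Q.dropLast, by rw [← hQlast, List.dropLast_append_getLast]⟩
  -- propagate the winding number along `hvOrigin :: Q`
  have hpath : (hvOrigin :: Q).IsChain hvGraph.Adj := by
    rw [hQt] at hQc ⊢
    exact List.IsChain.cons_cons adj_wOut_hvOrigin.symm hQc
  have hint : ∀ x ∈ (hvOrigin :: Q).tail.dropLast, x ∉ c := fun x hx hxc =>
    hQV x ((List.dropLast_sublist Q).subset hx) (hc x hxc)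
  have hd₁ : (hvOrigin, wOut) ∈ pdarts (hvOrigin :: Q) := by
    rw [hQt, pdarts_cons_cons]; exact List.mem_cons_self
  have hd₂ : ((hvOrigin :: Q₀).getLast (List.cons_ne_nil _ _), y') ∈ pdarts (hvOrigin :: Q) := by
    rw [hQ₀, ← List.cons_append, pdarts_append_singleton _ (List.cons_ne_nil _ _)]
    exact List.mem_append_right _ (List.mem_singleton_self _)
  have key := wnd_rightFace_pdarts_eq hadj _ hpath hint _ hd₁ _ hd₂
  -- the face to the right of the last dart is beyond `V`
  have hg : hvGraph.Adj ((hvOrigin :: Q₀).getLast (List.cons_ne_nil _ _)) y' :=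
    adj_of_mem_pdarts hpath _ hd₂
  have hfar : wnd c (rightFace ((hvOrigin :: Q₀).getLast (List.cons_ne_nil _ _)) y') = 0 := by
    refine wnd_eq_zero_of_fst_ne fun w hw => ?_
    have hw1 := hN' w (hc w hw)
    rcases leftFace_fst_of_adj hg.symm with h | h <;> rw [rightFace, h] <;> omega
  simp only [hfar] at key
  -- the two faces at the entrance edge agree (`wOut ∉ c`)
  have hwc : wOut ∉ c := fun h => hQV wOut (by rw [hQt]; exact List.mem_cons_self) (hc _ h)
  have hlr := wnd_faces_at_eq hadj hwc adj_wOut_hvOrigin adj_wOut_hvOrigin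
  rw [show ((1 : ℤ), (0 : ℤ)) = rightFace wOut hvOrigin by decide, ← hlr]
  exact key

end Outside

/-! ### Winding numbers of dart sums along paths: independence of the path -/

section Splice

/-- A list of length `≥ 2` starts with two entries. [folklore] -/
theorem exists_cons_cons_of_two_le {V : Type*} :
    ∀ (L : List V), 2 ≤ L.length → ∃ p q R, L = p :: q :: R
  | [], h => by simp at h
  | [_], h => by simp at h
  | p :: q :: R, _ => ⟨p, q, R, rfl⟩

/-- **Splicing two paths with common endpoints into a closed walk**: if `A = x₁ :: x₂ :: A'` and
`B̃ = p :: q :: R` with `B̃.head = A.getLast` and `B̃.getLast = A.head`, the winding number of the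
cyclic list `A.tail ++ B̃.tail` around any face is the dart sum along `A` plus the dart sum along
`B̃`. [folklore] -/
theorem wnd_tail_append_tail (x₁ x₂ p q : HV) (A' R : List HV) (F : ℤ × ℤ)
    (h₁ : ∀ h, (x₂ :: A').getLast h = p) (h₂ : ∀ h, (q :: R).getLast h = x₁) :
    wnd ((x₂ :: A') ++ (q :: R)) F =
      dwnd (pdarts (x₁ :: x₂ :: A')) F + dwnd (pdarts (p :: q :: R)) F := by
  rw [wnd_eq_dwnd, cdarts_append _ _ (List.cons_ne_nil _ _) (List.cons_ne_nil _ _),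
    h₁, h₂]
  simp only [dwnd_append, dwnd_cons, dwnd_nil, pdarts_cons_cons, List.head_cons]
  ring

/-- The dart sum along the reverse of a path is minus the dart sum along the path. [folklore] -/
theorem dwnd_pdarts_reverse (B : List HV) (F : ℤ × ℤ) :
    dwnd (pdarts B.reverse) F = -dwnd (pdarts B) F := by
  rw [pdarts_reverse, dwnd_perm (List.reverse_perm _), dwnd_map_swap]

variable {Λ : Finset HexVertex} {u : HexVertex} {Φ : hexGraph ≃g hvGraph}

/-- **Path independence of the dart sum at the entrance face.** For two lattice paths `A`, `B`
of `Φ(Λ)` (at least two vertices each) with the same first and the same last vertex, the winding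
sums of their darts around the entrance face `(1, 0)` agree: the difference is the winding number
of the closed walk `A · B⁻¹ ⊂ Φ(Λ)`, which vanishes by `wnd_eq_zero_of_simplyConnected'`.
[cite: DuminilCopinSmirnov2012, §2 and §4 (simply connected domains)] -/
theorem dwnd_pdarts_eq_of_endpoints (hΛ : hexDomainSimplyConnected Λ) (hu : u ∉ Λ)
    (hΦu : Φ u = wOut) {A B : List HV} (hA : A.IsChain hvGraph.Adj) (hB : B.IsChain hvGraph.Adj)
    (hAV : ∀ x ∈ A, x ∈ Λ.map Φ.toEquiv.toEmbedding)
    (hBV : ∀ x ∈ B, x ∈ Λ.map Φ.toEquiv.toEmbedding)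
    (h2A : 2 ≤ A.length) (h2B : 2 ≤ B.length)
    (hhead : A.head? = B.head?) (hlast : A.getLast? = B.getLast?) :
    dwnd (pdarts A) (1, 0) = dwnd (pdarts B) (1, 0) := by
  obtain ⟨x₁, x₂, A', rfl⟩ := exists_cons_cons_of_two_le A h2A
  obtain ⟨p, q, R, hB'⟩ := exists_cons_cons_of_two_le B.reverse (by simpa using h2B)
  have hBne : B ≠ [] := by rintro rfl; simp at h2B
  -- endpoints
  have eB1 : B.head hBne = x₁ := by
    have h := hhead
    rw [List.head?_cons, List.head?_eq_some_head hBne] at h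
    exact (Option.some.inj h).symm
  have eB2 : ∀ h, (x₁ :: x₂ :: A').getLast h = B.getLast hBne := by
    intro h
    have h' := hlast
    rw [List.getLast?_eq_some_getLast h, List.getLast?_eq_some_getLast hBne] at h'
    exact Option.some.inj h'
  have hBrne : B.reverse ≠ [] := by simpa using hBne
  have ep : B.getLast hBne = p := by
    rw [← List.head_reverse hBrne]; simp only [hB', List.head_cons]
  have ex : B.head hBne = (p :: q :: R).getLast (List.cons_ne_nil _ _) := by
    rw [← List.getLast_reverse hBrne]; simp only [hB']
  have h₁ : ∀ h, (x₂ :: A').getLast h = p := by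
    intro h; rw [← ep, ← eB2 (List.cons_ne_nil _ _)]; exact (List.getLast_cons h).symm
  have h₂ : ∀ h, (q :: R).getLast h = x₁ := by
    intro h; rw [← eB1, ex]; exact (List.getLast_cons h).symm
  -- the reversed path is a lattice path of `Φ(Λ)`
  have hBr : B.reverse.IsChain hvGraph.Adj :=
    List.isChain_reverse.2 (hB.imp fun x y h => h.symm)
  rw [hB'] at hBr
  have hBrV : ∀ x ∈ p :: q :: R, x ∈ Λ.map Φ.toEquiv.toEmbedding := by
    intro x hx; rw [← hB', List.mem_reverse] at hx; exact hBV x hx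
  -- the closed walk `A.tail ++ B̃.tail`
  have hZ := wnd_tail_append_tail x₁ x₂ p q A' R (1, 0) h₁ h₂
  have hZ0 : wnd ((x₂ :: A') ++ (q :: R)) (1, 0) = 0 := by
    refine wnd_eq_zero_of_simplyConnected' hΛ hu hΦu _ (fun x hx => ?_) (fun d hd => ?_)
    · rcases List.mem_append.1 hx with hx | hx
      · exact hAV x (List.mem_cons_of_mem _ hx)
      · exact hBrV x (List.mem_cons_of_mem _ hx)
    · rw [cdarts_append _ _ (List.cons_ne_nil _ _) (List.cons_ne_nil _ _), h₁, h₂] at hd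
      simp only [List.mem_append, List.mem_cons, List.head_cons, List.not_mem_nil,
        or_false] at hd
      rcases hd with (hd | rfl | hd) | rfl
      · exact adj_of_mem_pdarts (List.isChain_cons_cons.1 hA).2 d hd
      · exact (List.isChain_cons_cons.1 hBr).1
      · exact adj_of_mem_pdarts (List.isChain_cons_cons.1 hBr).2 d hd
      · exact (List.isChain_cons_cons.1 hA).1
  have hrev : dwnd (pdarts (p :: q :: R)) (1, 0) = -dwnd (pdarts B) (1, 0) := by
    rw [← hB']; exact dwnd_pdarts_reverse B (1, 0)
  rw [hZ0, hrev] at hZ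
  linarith

end Splice

/-! ### Orientation of a simple cycle through the entrance dart -/

section Orientation

/-- **The orientation of a simple cycle through the entrance dart is read off at the entrance
face**: a simple cycle of `ℍ` containing the dart `wOut → hvOrigin` has turning number `+6`
and winding number `0` around the face `(1, 0)` to the right of that dart, or turning number
`-6` and winding number `-1` there (discrete Umlaufsatz `HV.good_or_good_reverse` plus the jump
of the winding number across a dart of the cycle). [folklore] -/
theorem cturn_and_wnd_entrance {l : List HV} (hc : IsCyc l) (hd : (wOut, hvOrigin) ∈ cdarts l) :
    (cturn l = 6 ∧ wnd l (1, 0) = 0) ∨ (cturn l = -6 ∧ wnd l (1, 0) = -1) := by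
  have hR : rightFace wOut hvOrigin = ((1 : ℤ), (0 : ℤ)) := by decide
  rcases good_or_good_reverse hc with hg | hg
  · exact Or.inl ⟨hg.1, hR ▸ hg.2 _ hd⟩
  · have hg' := (good_reverse_iff hc.1).1 hg
    have h0 : wnd l (leftFace wOut hvOrigin) = 0 := hg'.2 _ hd
    have h1 := wnd_left_sub_right hc.2.2 adj_wOut_hvOrigin (l := l)
    rw [hc.flux_eq_one hd, hR, h0] at h1
    exact Or.inr ⟨hg'.1, by omega⟩

/-- Two simple cycles through the entrance dart with the same winding number around the entrance
face have the same turning number. [folklore] -/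
theorem cturn_eq_of_wnd_entrance_eq {l l' : List HV} (hc : IsCyc l) (hc' : IsCyc l')
    (hd : (wOut, hvOrigin) ∈ cdarts l) (hd' : (wOut, hvOrigin) ∈ cdarts l')
    (hw : wnd l (1, 0) = wnd l' (1, 0)) : cturn l = cturn l' := by
  rcases cturn_and_wnd_entrance hc hd with ⟨h1, h2⟩ | ⟨h1, h2⟩ <;>
    rcases cturn_and_wnd_entrance hc' hd' with ⟨h3, h4⟩ | ⟨h3, h4⟩ <;> omega

end Orientation

end Summit.CriticalPhenomena.SAWScalingLimit.Theorems.BoundaryWindingRigidity
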